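import Summits.CriticalPhenomena.PercolationContinuityZ3.Theorems.SoloInformedSheetGluing
import HarnessLib

/-!
# The sheet calculus: what gluing and a Bollobás–Riordan step can and cannot derive
(solo seat `solo-CriticalPhenomena-informed`, paper §7b.3 (d7))

Bookkeeping for lower bounds on closed separating SHEETS of boxes in `ℤ³`.  A *shape* `(a, b, t)`
stands for the box `[0,a] × [0,b] × [0,t]` and the event "no open path inside the box from
`{x₃ = 0}` to `{x₃ = t}`" (a closed sheet spanning `a × b` at thickness `t`;
`(vertCrossing …)ᶜ` of `SoloInformedSheetGluing`).  Its probability is non-increasing in `a`, `b`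
and non-decreasing in `t`, and invariant under `a ↔ b` (lattice isometry).  A *calculus* is a set of
rules producing shapes with a lower bound `≥ c > 0` (along a sequence of scales) from shapes already
known to have one.  The rules recorded here are

* `mono`, `swap` — the monotonicity and the isometry above;
* `glue` — the curtain-gluing inequality `real_sheet_gluing_sq` (kernel, `SoloInformedSheetGluing`):
  sheets of `[0,ℓ] × [b] × [t]` and of its translate by `ℓ - w`, plus an `x₁`-curtain of the overlap
  `[ℓ-w, ℓ] × [b] × [t]` — which after the isometry `x₁ ↔ x₃` is a sheet of shape `(t, b, w)` —
  give a sheet of `(2ℓ - w, b, t)`;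
* `br`, `br2` — the HYPOTHETICAL sheet version of [BollobasRiordan2006, Lemma 6 + Cor. 7]
  (paper (d6)): anchor = `x₁`-sheet of the base box `S = [t₀] × [b] × [h]` (shape `(h, b, t₀)`),
  virtually doubled by the mirror `x₃ ↦ 2h - x₃` (`br2`: also by `x₂ ↦ -x₂`), transversal sheet of
  `R = [m] × [b] × [2h]` (resp. `[m] × [2b] × [2h]`), the real sheet `Ξ` of the base column's bottom
  box, Harris assembly; output `(2m - t₀, b, 2h)` (resp. `(2m - t₀, 2b, 2h)`).  In `d = 2` the rule
  `br` with `h = t₀`, `b` absent, IS Bollobás–Riordan's `h_{2m-n,2n} ≥ h_{m,2n}² / 2⁵`.  Its `d = 3`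
  proof fails at the one-point dichotomy (paper (d6)(iii)); the point of this file is what it would
  buy IF proved.

Results (all by induction on derivations; arithmetic by `omega`).  Shapes classes are `Bool`-valued and
derivations `SheetCalc` are data (`Type`-valued trees), so nothing here postulates a proposition.

* `SheetCalc.loose` — WITHOUT `br`/`br2`, the class `LooseShape = {a ≤ t ∨ b ≤ t}` ("at most one
  lateral side exceeds the thickness", hardness type `≤ 1`) is closed: curtain gluing never raises the
  number of hard lateral directions.  The cube face `(Q)` (`SoloInformedCubeFace`) needs type 2
  (both lateral sides `> t`), so no amount of gluing reaches it from cubes, tall columns, ribbons or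
  thin-slab sheets.
* `SheetCalc.tame` — WITH `br` and `br2`, the smaller class
  `TameShape = {a ≤ t ∧ b ≤ t} ∪ {2a ≤ t} ∪ {2b ≤ t}` (sub-cubes, or cross-section at most one half)
  is still closed.  Hence from the cube seed `{a ≤ t ∧ b ≤ t}` even a valid Bollobás–Riordan lemma for
  sheets derives neither an `ε`-elongated SQUARE BEAM `((1+ε)t, t, t)` nor any type-2 shape
  (`cubeSeed_misses_nearCube`, `cubeSeed_misses_squareBeam`).
* `nearCube_of_looseSeed` — sharpness: from type-`≤ 1` seeds (square beams of every aspect) ONE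
  application of `br` yields `(6, 6, 4)`, the `r = 4`, `u = 1` near-cube brick of the cube face
  `(Q)`, which is not tame (`not_tame_nearCube`).

Reading (paper (d7)).  Through the box faces the conjunct `θ(p_c) = 0` on `ℤ³` needs exactly two
non-gluing inputs about sheets: a type-raising seed `cube ⇒ ε-long square beam` AND the
Bollobás–Riordan step with a long square-beam anchor; gluing supplies everything else.

References.  [BollobasRiordan2006] B. Bollobás, O. Riordan, *A short proof of the Harris–Kesten
theorem*, Bull. LMS 38 (2006), arXiv:math/0410359, Lemma 6, Cor. 7.
-/

namespace Summit.CriticalPhenomena.PercolationContinuityZ3.Theorems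

/-- Hardness type `≤ 1`: at most one lateral side exceeds the thickness. -/
def looseShape (a b t : ℕ) : Bool := decide (a ≤ t ∨ b ≤ t)

/-- Sub-cube, or one lateral side at most half the thickness. -/
def tameShape (a b t : ℕ) : Bool := decide ((a ≤ t ∧ b ≤ t) ∨ 2 * a ≤ t ∨ 2 * b ≤ t)

/-- The cube seed: both lateral sides at most the thickness (monotone images of cubes). -/
def cubeSeed (a b t : ℕ) : Bool := decide (a ≤ t ∧ b ≤ t)

/-- Unfolding of `looseShape`. -/
theorem looseShape_iff {a b t : ℕ} : looseShape a b t = true ↔ (a ≤ t ∨ b ≤ t) := by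
  simp [looseShape]

/-- Unfolding of `tameShape`. -/
theorem tameShape_iff {a b t : ℕ} :
    tameShape a b t = true ↔ ((a ≤ t ∧ b ≤ t) ∨ 2 * a ≤ t ∨ 2 * b ≤ t) := by
  simp [tameShape]

/-- Unfolding of `cubeSeed`. -/
theorem cubeSeed_iff {a b t : ℕ} : cubeSeed a b t = true ↔ (a ≤ t ∧ b ≤ t) := by
  simp [cubeSeed]

/-- Tame shapes are loose. -/
theorem loose_of_tame {a b t : ℕ} (h : tameShape a b t = true) : looseShape a b t = true := by
  rw [tameShape_iff] at h; rw [looseShape_iff]; omega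

/-- Cube-seed shapes are tame. -/
theorem tame_of_cubeSeed {a b t : ℕ} (h : cubeSeed a b t = true) : tameShape a b t = true := by
  rw [cubeSeed_iff] at h; rw [tameShape_iff]; omega

/-- Derivations of shapes from `Seed` by monotonicity, the lateral isometry, curtain gluing
(`real_sheet_gluing_sq`) and — only when `BR = true` — the hypothetical Bollobás–Riordan rules.
Data (`Type`-valued derivation trees). -/
inductive SheetCalc (Seed : ℕ → ℕ → ℕ → Bool) (BR : Bool) : ℕ → ℕ → ℕ → Type
  | seed {a b t : ℕ} : Seed a b t = true → SheetCalc Seed BR a b t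
  | mono {a b t a' b' t' : ℕ} : SheetCalc Seed BR a b t → a' ≤ a → b' ≤ b → t ≤ t' →
      SheetCalc Seed BR a' b' t'
  | swap {a b t : ℕ} : SheetCalc Seed BR a b t → SheetCalc Seed BR b a t
  | glue {ℓ b t w : ℕ} : SheetCalc Seed BR ℓ b t → SheetCalc Seed BR t b w → w ≤ ℓ →
      SheetCalc Seed BR (2 * ℓ - w) b t
  | br {t₀ h b m : ℕ} : BR = true → SheetCalc Seed BR h b t₀ → SheetCalc Seed BR m b (2 * h) →
      SheetCalc Seed BR t₀ b h → t₀ ≤ m → SheetCalc Seed BR (2 * m - t₀) b (2 * h)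
  | br2 {t₀ h b m : ℕ} : BR = true → SheetCalc Seed BR h b t₀ →
      SheetCalc Seed BR m (2 * b) (2 * h) → SheetCalc Seed BR t₀ (2 * b) h → t₀ ≤ m →
      SheetCalc Seed BR (2 * m - t₀) (2 * b) (2 * h)

namespace SheetCalc

variable {Seed : ℕ → ℕ → ℕ → Bool} {BR : Bool}

/-- **Gluing is type-preserving.**  Without the Bollobás–Riordan rules, type-`≤ 1` seeds only ever
give type-`≤ 1` shapes. -/
theorem loose (hBR : BR = false) (hS : ∀ a b t, Seed a b t = true → looseShape a b t = true)
    {a b t : ℕ} (h : SheetCalc Seed BR a b t) : looseShape a b t = true := by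
  induction h with
  | seed hs => exact hS _ _ _ hs
  | mono _ ha hb ht ih => rw [looseShape_iff] at *; omega
  | swap _ ih => rw [looseShape_iff] at *; omega
  | glue _ _ hw ih₁ ih₂ => rw [looseShape_iff] at *; omega
  | br hbr => rw [hBR] at hbr; exact absurd hbr (by decide)
  | br2 hbr => rw [hBR] at hbr; exact absurd hbr (by decide)

/-- **Even with the Bollobás–Riordan rules, tame seeds give tame shapes.**  The output of `br`/`br2`
inherits the passive width of its anchor, and a tame anchor with active cross-section `h × t₀` has
passive width at most half the output thickness `2h`. -/
theorem tame (hS : ∀ a b t, Seed a b t = true → tameShape a b t = true) {a b t : ℕ}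
    (h : SheetCalc Seed BR a b t) : tameShape a b t = true := by
  induction h with
  | seed hs => exact hS _ _ _ hs
  | mono _ ha hb ht ih => rw [tameShape_iff] at *; omega
  | swap _ ih => rw [tameShape_iff] at *; omega
  | glue _ _ hw ih₁ ih₂ => rw [tameShape_iff] at *; omega
  | br _ _ _ _ hm ih₁ ih₂ ih₃ => rw [tameShape_iff] at *; omega
  | br2 _ _ _ _ hm ih₁ ih₂ ih₃ => rw [tameShape_iff] at *; omega

end SheetCalc

/-- The `r = 4`, `u = 1` near-cube brick `[1,5] × [0,6]²` of the cube face `(Q)` — lateral `6 × 6`,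
thickness `4` — is not tame … -/
theorem not_tame_nearCube : tameShape 6 6 4 = false := by decide

/-- … nor loose (it has hardness type 2), -/
theorem not_loose_nearCube : looseShape 6 6 4 = false := by decide

/-- and the `ε`-elongated square beam `(3, 2, 2)` is loose but not tame. -/
theorem not_tame_squareBeam : tameShape 3 2 2 = false ∧ looseShape 3 2 2 = true := by decide

/-- **From the cube seed, Bollobás–Riordan for sheets would not reach the cube face:** no derivation —
gluing and both BR rules allowed — produces the near-cube brick. -/
theorem cubeSeed_misses_nearCube (BR : Bool) (h : SheetCalc cubeSeed BR 6 6 4) : False := by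
  have := h.tame fun _ _ _ hs => tame_of_cubeSeed hs
  rw [not_tame_nearCube] at this; exact absurd this (by decide)

/-- Nor does it produce an `ε`-elongated square beam. -/
theorem cubeSeed_misses_squareBeam (BR : Bool) (h : SheetCalc cubeSeed BR 3 2 2) : False := by
  have := h.tame fun _ _ _ hs => tame_of_cubeSeed hs
  rw [not_tame_squareBeam.1] at this; exact absurd this (by decide)

/-- **Without BR, no type-≤ 1 seed set reaches the near-cube brick.** -/
theorem looseSeed_misses_nearCube (h : SheetCalc looseShape false 6 6 4) : False := by
  have := h.loose rfl fun _ _ _ hs => hs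
  rw [not_loose_nearCube] at this; exact absurd this (by decide)

/-- **Sharpness: square beams + ONE Bollobás–Riordan step give the near-cube brick.**  Anchor: the
square beam `(2, 6, 2)` (an `x₁`-sheet of `[2] × [6] × [2]` spanning `6 × 2` at thickness `2`);
transversal sheet `(4, 6, 4)`; `Ξ = (2, 6, 2)`; `m = 4`, `t₀ = h = 2`; output
`(2·4 - 2, 6, 2·2) = (6, 6, 4)`. -/
def nearCube_of_looseSeed : SheetCalc looseShape true 6 6 4 :=
  (SheetCalc.br (t₀ := 2) (h := 2) (b := 6) (m := 4) rfl (SheetCalc.seed (by decide))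
    (SheetCalc.seed (by decide)) (SheetCalc.seed (by decide)) (by decide) :
    SheetCalc looseShape true (2 * 4 - 2) 6 (2 * 2))

/-- Gluing alone, from the `ε`-long square beam `(3,2,2)` and the cube `(2,2,2)`, elongates square
beams: `(4,2,2)`, then `(6,2,2)` (two uses of `real_sheet_gluing_sq`'s shape rule). -/
def squareBeams_of_seedBeam (Seed : ℕ → ℕ → ℕ → Bool) (BR : Bool) (h3 : Seed 3 2 2 = true)
    (h2 : Seed 2 2 2 = true) : SheetCalc Seed BR 6 2 2 :=
  have g4 : SheetCalc Seed BR (2 * 3 - 2) 2 2 :=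
    SheetCalc.glue (SheetCalc.seed h3) (SheetCalc.seed h2) (by decide)
  (SheetCalc.glue g4 (SheetCalc.seed h2) (by decide) : SheetCalc Seed BR (2 * (2 * 3 - 2) - 2) 2 2)

end Summit.CriticalPhenomena.PercolationContinuityZ3.Theorems
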